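import Summits.QuantumFields.YangMills.Theorems.BalabanUVNodesN15CurvedDressedPairDefect
import Summits.QuantumFields.YangMills.Theorems.BalabanUVNodesN15CurvedGradientFit
import Summits.QuantumFields.YangMills.Theorems.BalabanUVNodesN15CurvedTransporterOrthogonality
import HarnessLib

/-!
# Route «BalabanUVNodes» (cluster K4 «SpineRates»), Track-A DAG node N15 = NE2, BACKGROUND LAYER — KNIT: NE2⁺ (entries 0∕1, block-defect form) PROPAGATES FROM `U` TO
# `e^{ηZ}·U` UNDER (3.35)–(3.37)-SHAPED GENERATOR DATA — file 4's `hasMaj_idef_curvDressed` with ALL TEN transporter-level letters∕fits INHABITED by files 5–6 at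
# `S = coordMat e (e^{ηZ})`, `R = coordMat e (e^{ηW})` on both grids

Cell `pub-ymgap`, seat `pub-ymgap-dag-n15-w3` (WIDTH SEAT 3∕3 on node N15, director-ym №197 ∕ HUMAN RULING D-0149; plan `W-SEAT-START-LIST.md` §n15 item 3 «`NE2PlusOperator`
for the background layer at GENERAL small-field U» — seventh piece, the KNIT of pieces 4–6).  `bears_on: R4∕N15 · K3⁷ SpineGivenEndpointR13SepCoPH (stmt-QuantumFields-20544)`.
Filed `--kind proof --supports stmt-QuantumFields-20544 --as helper` — COUNT-NEUTRAL.  Imports BY NAME this seat's file 4 `…N15CurvedDressedPairDefect` (p587618: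
`hasMaj_idef_curvDressed`, `curvFitLetter`, `curvRowLetter`, `curvDressed`, `covPieces`, `gaugePair`), file 6 `…N15CurvedGradientFit` (p592859: `fit_covShiftDefect_exp`,
`gradFitLetter`; through it file 5 `expTrField`, `transporterLetter_exp`, `fieldLetter_curvCoefA_exp`, `fit_curvCoefA_inl_exp`, `fitTranslated_curvCoefA_inl_exp`,
`fitTranslated_expTrField`, `covShiftLetter_exp`) and dag-n15-w2 g2's `…N15CurvedTransporterOrthogonality` (p593011: the three `expTrField_…_of_skew` suppliers); nothing in the
tree is modified.

WHY.  File 4's theorem — the η-defect of the Neumann-dressed pair `X̂(U′U)` at two spacings is bounded by the η-defects of `(G(U), D^±_RG(U))` AT THE BASE POINT (NE2⁺ entries 0∕1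
at `U`, block form) and the coefficient fits — displays TEN transporter-level letters∕fits about the perturbation `S` and the background transporters `R` on the two grids: the
field letters `|S − 1| ≤ ηp₀`, the covariant-gradient letters `|S_μ − R₋ᵀS₋R₋| ≤ η²q₀`, the coefficient letter `|a⁺| ≤ p`, and the four fits `o_a, o_t, o_R, o_g`.  Files 5–6
discharged each of them, one theorem per letter, from GENERATOR-LEVEL data of the (3.35)–(3.37) shape at `S = expTrField e η Z`, `R = expTrField e η W`
([Balaban1985BackgroundPropagators] (3.37) p. 396: *«U′ = e^{iηA′}, … |A′| < α₁(L^jη)^{−1}, |∇^η_U A′| < α₁(L^jη)^{−2}»*).  THIS FILE is the one-theorem KNIT: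

* §1 `fitTranslated_of_fit_of_compat` — how the two TRANSLATED generator fits (`o_t`, `o_W`) follow from plain fits, the gradient letters and the BLOCK-NEIGHBOUR COMPATIBILITY
  of `(π, τ, τ′)` (`π((τ′_μ)⁻¹x′) ∈ {πx′, (τ_μ)⁻¹(πx′)}` — one fine step back stays in the block or enters the preceding block): `o_t ≤ o + ηg` (rate one kept);
* §2 the generator-level letters of the knit: `expRowLetter` (= file 2's `curvRowLetter` at `p₀ = κ_e e r`, `q₀ = κ_e(e g + e²(2+e) r r_B)`), `expFitLetter` (= file 4's `curvFitLetter` at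
  `p = κ_e e r`, `o_a = κ_e(e o + 2e r²η)`, `o_t = κ_e(e o_t + 2e r²η)`, `o_R = 2η κ_e e r_B`, `o_g = κ_e·gradFitLetter …`), nonnegativity;
* §3 ★★★ `hasMaj_idef_curvDressed_exp` — file 4's `hasMaj_idef_curvDressed` VERBATIM IN ITS CONCLUSION with the transporter-level hypotheses replaced by: sizes `‖Z‖, ‖Z′‖ ≤ r`,
  `‖W‖, ‖W′‖ ≤ r_B`, gradient letters `‖Z₊ − Z₋‖ ≤ ηg` (both grids), the plain fit `o`, the translated fits `o_t`, `o_W`, the lattice-derivative fit `o_D`, regimes `η₀r, η₀r_B ≤ 1`,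
  `0 < η′ ≤ η ≤ η₀`, and the ORTHOGONALITY MODEL (`SSᵀ = 1`, `RᵀR = RRᵀ = 1`, `Rᵀ = coordMat e (e^{−ηW})` on both grids — displayed);
* ★★★ `hasMaj_idef_curvDressed_exp_of_skew` — the same with the orthogonality model DISCHARGED by dag-n15-w2 g2's `…N15CurvedTransporterOrthogonality` (p593011:
  `expTrField_mul_transpose_of_skew`, `expTrField_transpose_mul_of_skew`, `expTrField_transpose_eq_of_skew`): SKEW generators in the coordinates `e` on both grids — after it the
  displayed data are the carrier, the base-point majorants∕defects, the Neumann smallness and GENERATOR-LEVEL letters∕fits only.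

HONEST FRAMING ∕ LIMITS.  A knit (no new estimate): bookkeeping over files 4–6 ([B9] (3.35)–(3.37) p. 396, (3.42) p. 397, (3.52)–(3.53) p. 400, (3.63)–(3.65) pp. 402–403 =
SHAPES ∕ MECHANISM; nothing of [B9] asserted).  DISPLAYED after the knit: the [B6] carrier data, the (3.42)₀,₁-shaped block majorants AND η-defects of `G(U)`, `D^±_RG(U)` at the
curved base point (the inductive datum), the Neumann smallness `q < 1`, the orthogonality model, and the generator-level letters∕fits themselves (`o`, `o_t`, `o_W`: (C3)∕NE3-type
transport letters; `o_D`: the (3.36)-type window letter of n15-b 12b, linearised transport); crude constants; the base case `U ≡ 1` is the lineage's (dag-n15-c), the gluing of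
cube-wise gauges is [B6]'s (untouched).  NE2⁺ NOT PRINTED, NOT proved; N15 NOT discharged; counts of record UNMOVED (typed 28∕28 · discharged 5∕27); one finite 𝕋⁴ at fixed ε —
NOT infinite volume, NOT OS on ℝ⁴, NOT a mass gap, NOT Clay; R4 closes the conditional finite-𝕋⁴ rung `BalabanLadder.UV` only.  Restate-immune (no Theses import).
-/

set_option autoImplicit false

noncomputable section
open scoped BigOperators Matrix
open Finset NormedSpace

namespace Summit.QuantumFields.YangMills.BalabanUVNodes.N15.CurvedSpecies

open Literature.MathematicalPhysics.QuantumFieldTheory.Balaban1983to89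
open Literature.MathematicalPhysics.QuantumFieldTheory.Balaban1983to89.B11SectG (BlockNorm HasMaj RowSum)
open Literature.MathematicalPhysics.QuantumFieldTheory.Balaban1983to89.T4EtaRateDefect (idef)
open Literature.MathematicalPhysics.QuantumFieldTheory.Balaban1983to89.T4EtaRateCoeffDefect (pull)
open Literature.MathematicalPhysics.QuantumFieldTheory.Balaban1983to89.B6RandomWalk (Triangle254)
open Summit.QuantumFields.YangMills.BalabanUVNodes.N15.MatrixSpecies (liftMap liftBlk Phi0 coordMat basisConst basisConst_nonneg)
open Summit.QuantumFields.YangMills.BalabanUVNodes.N15.BackgroundLayer (liftPair blkPair)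

/-! ## §1 Translated fits from plain fits under block-neighbour compatibility -/

section Transfer

variable {X X' J V : Type} [NormedAddCommGroup V]

/-- ★ **TRANSLATED FIT FROM THE PLAIN FIT** (rate one kept).  If the block map is NEIGHBOUR-COMPATIBLE with the two families of steps — one fine step back from `x′` lands in the
block of `x′` or in the block one coarse step back, `π((τ′_μ)⁻¹x′) ∈ {πx′, (τ_μ)⁻¹(πx′)}` — then the plain fit `‖a′_μ(x′) − a_μ(πx′)‖ ≤ o` and the coarse gradient letter
`‖a_μ(x) − a_μ(x − e_μ)‖ ≤ γ` give the fit at the translated pair of points: `‖a′_μ((τ′_μ)⁻¹x′) − a_μ((τ_μ)⁻¹(πx′))‖ ≤ o + γ` (files 5–6's `o_t`, `o_W` at `γ = ηg`).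
[cite: Balaban1985BackgroundPropagators, (3.35)–(3.37) p.396 (shapes)] -/
theorem fitTranslated_of_fit_of_compat (τ : J → X ≃ X) (τ' : J → X' ≃ X') (π : X' → X) {a : J → X → V} {a' : J → X' → V} {o γ : ℝ}
    (hcompat : ∀ μ x', π ((τ' μ).symm x') = π x' ∨ π ((τ' μ).symm x') = (τ μ).symm (π x'))
    (hfit : ∀ μ x', ‖a' μ x' - a μ (π x')‖ ≤ o) (hgrad : ∀ μ x, ‖a μ x - a μ ((τ μ).symm x)‖ ≤ γ) (μ : J) (x' : X') :
    ‖a' μ ((τ' μ).symm x') - a μ ((τ μ).symm (π x'))‖ ≤ o + γ := by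
  have hγ : 0 ≤ γ := (norm_nonneg _).trans (hgrad μ (π x'))
  rcases hcompat μ x' with h | h
  · have hsplit : a' μ ((τ' μ).symm x') - a μ ((τ μ).symm (π x')) =
        (a' μ ((τ' μ).symm x') - a μ (π ((τ' μ).symm x'))) + (a μ (π x') - a μ ((τ μ).symm (π x'))) := by rw [h]; abel
    rw [hsplit]
    exact (norm_add_le _ _).trans (add_le_add (hfit μ _) (hgrad μ _))
  · have hsplit : a' μ ((τ' μ).symm x') - a μ ((τ μ).symm (π x')) = a' μ ((τ' μ).symm x') - a μ (π ((τ' μ).symm x')) := by rw [h]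
    rw [hsplit]
    exact (hfit μ _).trans (le_add_of_nonneg_right hγ)

end Transfer

/-! ## §2 The generator-level letters of the knit -/

section Letters

variable (ι J : Type) [Fintype ι] [Fintype J]

/-- THE ROW LETTER at generator level: file 2's `curvRowLetter` at file 5's `p₀ = κ_e·e·r` (field) and `q₀ = κ_e·(e g + e²(2+e) r r_B)` (covariant gradient). [folklore] -/
def expRowLetter (κ r rB g : ℝ) : ℝ :=
  curvRowLetter ι J (κ * Real.exp 1 * r) (κ * (Real.exp 1 * g + Real.exp 1 ^ 2 * (2 + Real.exp 1) * r * rB))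

/-- THE FIT LETTER at generator level: file 4's `curvFitLetter` at `p = κ_e e r`, `o_a = κ_e(e o + 2e r²η)`, `o_t = κ_e(e o_t + 2e r²η)`, `o_R = 2η κ_e e r_B`,
`o_g = κ_e·gradFitLetter r r_B g o_D o_t o_W η` (files 5–6). [folklore] -/
def expFitLetter (κ r rB g o ot oW oD η : ℝ) : ℝ :=
  curvFitLetter ι J (κ * Real.exp 1 * r) (κ * (Real.exp 1 * o + 2 * (Real.exp 1 * r ^ 2) * η)) (κ * (Real.exp 1 * ot + 2 * (Real.exp 1 * r ^ 2) * η))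
    (2 * η * (κ * Real.exp 1 * rB)) (κ * gradFitLetter r rB g oD ot oW η)

/-- Nonnegativity of the row letter. [folklore] -/
theorem expRowLetter_nonneg {κ r rB g : ℝ} (hκ : 0 ≤ κ) (hr : 0 ≤ r) (hrB : 0 ≤ rB) (hg : 0 ≤ g) : 0 ≤ expRowLetter ι J κ r rB g :=
  curvRowLetter_nonneg (ι := ι) (J := J) (by positivity) (by positivity)

/-- Nonnegativity of the fit letter. [folklore] -/
theorem expFitLetter_nonneg {κ r rB g o ot oW oD η : ℝ} (hκ : 0 ≤ κ) (hr : 0 ≤ r) (hrB : 0 ≤ rB) (hg : 0 ≤ g) (ho : 0 ≤ o) (hot : 0 ≤ ot) (hoW : 0 ≤ oW)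
    (hoD : 0 ≤ oD) (hη : 0 ≤ η) : 0 ≤ expFitLetter ι J κ r rB g o ot oW oD η :=
  curvFitLetter_nonneg (ι := ι) (J := J) (by positivity) (by positivity) (by positivity) (by positivity)
    (mul_nonneg hκ (gradFitLetter_nonneg hr hrB hg hoD hot hoW hη))

end Letters

/-! ## §3 The knit -/

section Knit

variable {X X' ι J : Type} [Fintype X] [Fintype X'] [DecidableEq X] [DecidableEq X'] [Fintype ι] [DecidableEq ι] [Fintype J] [DecidableEq J]
variable {𝔄 : Type} [NormedRing 𝔄] [NormedAlgebra ℝ 𝔄] [CompleteSpace 𝔄] (e : 𝔄 ≃L[ℝ] (ι → ℝ))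
variable {geo : B6.Geometry} (blk : X → geo.Site) (π : X' → X)
variable (η η' : ℝ) (τ : J → X ≃ X) (τ' : J → X' ≃ X') (Z W : J → X → (𝔄 →L[ℝ] 𝔄)) (Z' W' : J → X' → (𝔄 →L[ℝ] 𝔄))
variable (G : (X × ι → ℝ) →ₗ[ℝ] (X × ι → ℝ)) (G' : (X' × ι → ℝ) →ₗ[ℝ] (X' × ι → ℝ))

/-- ★★★ **NE2⁺ (ENTRIES 0∕1, BLOCK-DEFECT FORM) PROPAGATES FROM `U` TO `e^{ηZ}·U` UNDER (3.35)–(3.37)-SHAPED GENERATOR DATA.**  File 4's `hasMaj_idef_curvDressed` at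
`S = expTrField e η Z`, `R = expTrField e η W` (coarse) and `S′ = expTrField e η′ Z′`, `R′ = expTrField e η′ W′` (fine), its ten transporter-level letters∕fits supplied by files 5–6
from: sizes `‖Z‖, ‖Z′‖ ≤ r`, `‖W‖, ‖W′‖ ≤ r_B`; lattice-gradient letters `‖Z_μ(x) − Z_μ(x − e_μ)‖ ≤ ηg` (coarse), `≤ η′g` (fine); the plain generator fit `‖Z′(x′) − Z(πx′)‖ ≤ o`, the
translated fits `o_t` (of `Z`), `o_W` (of `W`), the lattice-derivative fit `o_D`; regimes `η₀r ≤ 1`, `η₀r_B ≤ 1`, `0 < η′ ≤ η ≤ η₀`; the orthogonality model on both grids.  The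
remaining data are file 4's: the [B6] carrier, the (3.42)₀,₁-shaped block majorants `β e^{−δd}` of `G(U)`, `D^±_RG(U)` on both grids and their η-DEFECTS `≤ m e^{−δd}` (NE2⁺ at the
base point), `ρ + σ ≤ δ`, and the Neumann smallness `β·R_V·c_r < 1` at the generator-level row letter `R_V = expRowLetter …·(1 + |J ⊕ J|)`.  CONCLUSION: file 4's majorant of
the η-defect of the dressed pairs, with `curvRowLetter ↦ expRowLetter`, `curvFitLetter ↦ expFitLetter`. [cite: Balaban1985BackgroundPropagators, (3.35)–(3.37) p.396, (3.52)–(3.53) p.400, (3.63)–(3.65) pp.402–403 (shapes, mechanism)] -/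
theorem hasMaj_idef_curvDressed_exp (htri : Triangle254 geo) (hd : ∀ a b : geo.Site, 0 ≤ geo.dist a b) {σ cr : ℝ} (hσ : 0 ≤ σ) (hcr : 0 ≤ cr) (hrow : RowSum geo σ cr)
    {ρ δ β m η₀ r rB g o ot oW oD : ℝ} (hρ : 0 ≤ ρ) (hρδ : ρ + σ ≤ δ) (hβ : 0 ≤ β) (hm : 0 ≤ m)
    (hreg : η₀ * r ≤ 1) (hregB : η₀ * rB ≤ 1) (hη' : 0 < η') (hη'η : η' ≤ η) (hηη₀ : η ≤ η₀)
    (hr : 0 ≤ r) (hrB : 0 ≤ rB) (hg : 0 ≤ g) (ho : 0 ≤ o) (hot : 0 ≤ ot) (hoW : 0 ≤ oW) (hoD : 0 ≤ oD)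
    -- the U-layer at the curved base point, both grids, and its η-defects (entries 0∕1 of NE2⁺ at U)
    (hG : HasMaj (BlockNorm.ofBlocks geo (liftBlk blk ι)) (BlockNorm.ofBlocks geo (liftBlk blk ι)) G (fun y y' => β * Real.exp (-(δ * geo.dist y y'))))
    (hD : ∀ j, HasMaj (BlockNorm.ofBlocks geo (liftBlk blk ι)) (BlockNorm.ofBlocks geo (liftBlk blk ι)) (covPieces η τ (gaugePair τ (expTrField e η W)) G j)
      (fun y y' => β * Real.exp (-(δ * geo.dist y y'))))
    (hG' : HasMaj (BlockNorm.ofBlocks geo (liftBlk (blk ∘ π) ι)) (BlockNorm.ofBlocks geo (liftBlk (blk ∘ π) ι)) G' (fun y y' => β * Real.exp (-(δ * geo.dist y y'))))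
    (hD' : ∀ j, HasMaj (BlockNorm.ofBlocks geo (liftBlk (blk ∘ π) ι)) (BlockNorm.ofBlocks geo (liftBlk (blk ∘ π) ι))
      (covPieces η' τ' (gaugePair τ' (expTrField e η' W')) G' j) (fun y y' => β * Real.exp (-(δ * geo.dist y y'))))
    (hDG : HasMaj (BlockNorm.ofBlocks geo (liftBlk blk ι)) (BlockNorm.ofBlocks geo (liftBlk (blk ∘ π) ι))
      (idef (pull (liftMap π ι)) (pull (liftMap π ι)) G' G) (fun y y' => m * Real.exp (-(δ * geo.dist y y'))))
    (hDD : ∀ j, HasMaj (BlockNorm.ofBlocks geo (liftBlk blk ι)) (BlockNorm.ofBlocks geo (liftBlk (blk ∘ π) ι))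
      (idef (pull (liftMap π ι)) (pull (liftMap π ι)) (covPieces η' τ' (gaugePair τ' (expTrField e η' W')) G' j) (covPieces η τ (gaugePair τ (expTrField e η W)) G j))
      (fun y y' => m * Real.exp (-(δ * geo.dist y y'))))
    -- the generator-level data ((3.35)–(3.37) shapes), both grids
    (hZ : ∀ μ x, ‖Z μ x‖ ≤ r) (hZ' : ∀ μ x', ‖Z' μ x'‖ ≤ r) (hW : ∀ μ x, ‖W μ x‖ ≤ rB) (hW' : ∀ μ x', ‖W' μ x'‖ ≤ rB)
    (hgrad : ∀ μ x, ‖Z μ x - Z μ ((τ μ).symm x)‖ ≤ η * g) (hgrad' : ∀ μ x', ‖Z' μ x' - Z' μ ((τ' μ).symm x')‖ ≤ η' * g)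
    (hfit : ∀ μ x', ‖Z' μ x' - Z μ (π x')‖ ≤ o) (hfitT : ∀ μ x', ‖Z' μ ((τ' μ).symm x') - Z μ ((τ μ).symm (π x'))‖ ≤ ot)
    (hfitW : ∀ μ x', ‖W' μ ((τ' μ).symm x') - W μ ((τ μ).symm (π x'))‖ ≤ oW)
    (hfitD : ∀ μ x', ‖η'⁻¹ • (Z' μ x' - Z' μ ((τ' μ).symm x')) - η⁻¹ • (Z μ (π x') - Z μ ((τ μ).symm (π x')))‖ ≤ oD)
    -- the orthogonality model, both grids
    (hS : ∀ μ x, expTrField e η Z μ x * (expTrField e η Z μ x)ᵀ = 1) (hRo : ∀ μ x, (expTrField e η W μ x)ᵀ * expTrField e η W μ x = 1)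
    (hRo' : ∀ μ x, expTrField e η W μ x * (expTrField e η W μ x)ᵀ = 1) (hRt : ∀ μ y, (expTrField e η W μ y)ᵀ = coordMat e (Phi0 η (-(W μ y))))
    (hS' : ∀ μ x', expTrField e η' Z' μ x' * (expTrField e η' Z' μ x')ᵀ = 1) (hRf : ∀ μ x', (expTrField e η' W' μ x')ᵀ * expTrField e η' W' μ x' = 1)
    (hRf' : ∀ μ x', expTrField e η' W' μ x' * (expTrField e η' W' μ x')ᵀ = 1) (hRt' : ∀ μ y', (expTrField e η' W' μ y')ᵀ = coordMat e (Phi0 η' (-(W' μ y'))))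
    -- the Neumann smallness at the generator-level row letter
    (hq : β * (expRowLetter ι J (basisConst e) r rB g * (1 + Fintype.card (J ⊕ J))) * cr < 1) :
    HasMaj (BlockNorm.ofBlocks geo (liftBlk blk ι)) (BlockNorm.ofBlocks geo (blkPair (liftBlk (blk ∘ π) ι)))
      (idef (pull (liftMap π ι)) (pull (liftPair (liftMap π ι))) (curvDressed η' τ' (expTrField e η' W') (expTrField e η' Z') G')
        (curvDressed η τ (expTrField e η W) (expTrField e η Z) G))
      (fun y y' => (m * cr + 1 * (m * cr) * (expRowLetter ι J (basisConst e) r rB g * (1 + Fintype.card (J ⊕ J)) *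
          (β * (1 - β * (expRowLetter ι J (basisConst e) r rB g * (1 + Fintype.card (J ⊕ J))) * cr)⁻¹)) +
          β * (expFitLetter ι J (basisConst e) r rB g o ot oW oD η * (1 + Fintype.card (J ⊕ J))) *
            (β * (1 - β * (expRowLetter ι J (basisConst e) r rB g * (1 + Fintype.card (J ⊕ J))) * cr)⁻¹) * cr) *
        (1 - 1 * (β * (expRowLetter ι J (basisConst e) r rB g * (1 + Fintype.card (J ⊕ J))) * cr))⁻¹ * Real.exp (-(ρ * geo.dist y y'))) := by
  have hκ : 0 ≤ basisConst e := basisConst_nonneg e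
  have hη : 0 < η := lt_of_lt_of_le hη' hη'η
  have hη'₀ : η' ≤ η₀ := hη'η.trans hηη₀
  have hregη : η * r ≤ 1 := (mul_le_mul_of_nonneg_right hηη₀ hr).trans hreg
  have hregη' : η' * r ≤ 1 := (mul_le_mul_of_nonneg_right hη'₀ hr).trans hreg
  have hregBη : η * rB ≤ 1 := (mul_le_mul_of_nonneg_right hηη₀ hrB).trans hregB
  have hregBη' : η' * rB ≤ 1 := (mul_le_mul_of_nonneg_right hη'₀ hrB).trans hregB
  exact hasMaj_idef_curvDressed blk π η η' τ τ' (expTrField e η W) (expTrField e η Z) (expTrField e η' W') (expTrField e η' Z') G G' htri hd hσ hcr hrow hρ hρδ hβ hm hη hη'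
    (p₀ := basisConst e * Real.exp 1 * r) (q₀ := basisConst e * (Real.exp 1 * g + Real.exp 1 ^ 2 * (2 + Real.exp 1) * r * rB)) (p := basisConst e * Real.exp 1 * r)
    (oa := basisConst e * (Real.exp 1 * o + 2 * (Real.exp 1 * r ^ 2) * η)) (oat := basisConst e * (Real.exp 1 * ot + 2 * (Real.exp 1 * r ^ 2) * η))
    (oR := 2 * η * (basisConst e * Real.exp 1 * rB)) (og := basisConst e * gradFitLetter r rB g oD ot oW η)
    (by positivity) (by positivity) (by positivity) (by positivity) (by positivity) (by positivity) (mul_nonneg hκ (gradFitLetter_nonneg hr hrB hg hoD hot hoW hη.le))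
    hG hD hG' hD' hDG hDD hS hRo hRo'
    (fun μ x i j => transporterLetter_exp e η Z hη.le hregη hZ μ x i j) (fun μ x i j => covShiftLetter_exp e η τ Z W hη.le hregη hregBη hZ hW hgrad hRt μ x i j)
    hS' hRf hRf'
    (fun μ x' i j => transporterLetter_exp e η' Z' hη'.le hregη' hZ' μ x' i j) (fun μ x' i j => covShiftLetter_exp e η' τ' Z' W' hη'.le hregη' hregBη' hZ' hW' hgrad' hRt' μ x' i j)
    (fun μ x i j => fieldLetter_curvCoefA_exp e η Z τ (expTrField e η W) hη hregη hZ μ x i j)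
    (fun μ x' i j => fieldLetter_curvCoefA_exp e η' Z' τ' (expTrField e η' W') hη' hregη' hZ' μ x' i j)
    (fun μ x' i j => fit_curvCoefA_inl_exp e η Z τ (expTrField e η W) η' Z' τ' (expTrField e η' W') π hreg hη' hη'η hηη₀ hZ' hZ (fun μ x' => hfit μ x') μ x' i j)
    (fun μ x' i j => fitTranslated_curvCoefA_inl_exp e η Z τ (expTrField e η W) η' Z' τ' (expTrField e η' W') π hreg hη' hη'η hηη₀ hZ' hZ (fun μ x' => hfitT μ x') μ x' i j)
    (fun μ x' i j => fitTranslated_expTrField e η τ η' τ' π W W' hη'.le hη'η hregBη hW hW' μ x' i j)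
    (fun μ x' i j => fit_covShiftDefect_exp e η η' τ τ' π Z W Z' W' hreg hregB hη' hη'η hηη₀ hZ hZ' hW hW' hgrad hgrad' hfitD hfitT hfitW hRt hRt' μ x' i j)
    hq

/-- ★★★ **THE SAME WITH THE ORTHOGONALITY MODEL DISCHARGED** (dag-n15-w2 g2, p593011 `…N15CurvedTransporterOrthogonality`): in coordinates `e` in which every generator
`Z_μ(x), W_μ(x), Z′_μ(x′), W′_μ(x′)` is SKEW (`(coordMat e T)ᵀ = −coordMat e T` — orthonormal coordinates for an ad-invariant form), the eight model hypotheses of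
`hasMaj_idef_curvDressed_exp` hold by `expTrField_mul_transpose_of_skew`, `expTrField_transpose_mul_of_skew`, `expTrField_transpose_eq_of_skew`; what remains displayed is the
carrier, the base-point majorants∕defects (the inductive datum), the Neumann smallness and the generator-level letters∕fits ONLY. [cite: Balaban1985BackgroundPropagators, (3.35)–(3.37) p.396, (3.52)–(3.53) p.400, (3.63)–(3.65) pp.402–403 (shapes, mechanism)] -/
theorem hasMaj_idef_curvDressed_exp_of_skew (htri : Triangle254 geo) (hd : ∀ a b : geo.Site, 0 ≤ geo.dist a b) {σ cr : ℝ} (hσ : 0 ≤ σ) (hcr : 0 ≤ cr) (hrow : RowSum geo σ cr)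
    {ρ δ β m η₀ r rB g o ot oW oD : ℝ} (hρ : 0 ≤ ρ) (hρδ : ρ + σ ≤ δ) (hβ : 0 ≤ β) (hm : 0 ≤ m)
    (hreg : η₀ * r ≤ 1) (hregB : η₀ * rB ≤ 1) (hη' : 0 < η') (hη'η : η' ≤ η) (hηη₀ : η ≤ η₀)
    (hr : 0 ≤ r) (hrB : 0 ≤ rB) (hg : 0 ≤ g) (ho : 0 ≤ o) (hot : 0 ≤ ot) (hoW : 0 ≤ oW) (hoD : 0 ≤ oD)
    -- the U-layer at the curved base point, both grids, and its η-defects (entries 0∕1 of NE2⁺ at U)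
    (hG : HasMaj (BlockNorm.ofBlocks geo (liftBlk blk ι)) (BlockNorm.ofBlocks geo (liftBlk blk ι)) G (fun y y' => β * Real.exp (-(δ * geo.dist y y'))))
    (hD : ∀ j, HasMaj (BlockNorm.ofBlocks geo (liftBlk blk ι)) (BlockNorm.ofBlocks geo (liftBlk blk ι)) (covPieces η τ (gaugePair τ (expTrField e η W)) G j)
      (fun y y' => β * Real.exp (-(δ * geo.dist y y'))))
    (hG' : HasMaj (BlockNorm.ofBlocks geo (liftBlk (blk ∘ π) ι)) (BlockNorm.ofBlocks geo (liftBlk (blk ∘ π) ι)) G' (fun y y' => β * Real.exp (-(δ * geo.dist y y'))))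
    (hD' : ∀ j, HasMaj (BlockNorm.ofBlocks geo (liftBlk (blk ∘ π) ι)) (BlockNorm.ofBlocks geo (liftBlk (blk ∘ π) ι))
      (covPieces η' τ' (gaugePair τ' (expTrField e η' W')) G' j) (fun y y' => β * Real.exp (-(δ * geo.dist y y'))))
    (hDG : HasMaj (BlockNorm.ofBlocks geo (liftBlk blk ι)) (BlockNorm.ofBlocks geo (liftBlk (blk ∘ π) ι))
      (idef (pull (liftMap π ι)) (pull (liftMap π ι)) G' G) (fun y y' => m * Real.exp (-(δ * geo.dist y y'))))
    (hDD : ∀ j, HasMaj (BlockNorm.ofBlocks geo (liftBlk blk ι)) (BlockNorm.ofBlocks geo (liftBlk (blk ∘ π) ι))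
      (idef (pull (liftMap π ι)) (pull (liftMap π ι)) (covPieces η' τ' (gaugePair τ' (expTrField e η' W')) G' j) (covPieces η τ (gaugePair τ (expTrField e η W)) G j))
      (fun y y' => m * Real.exp (-(δ * geo.dist y y'))))
    -- the generator-level data ((3.35)–(3.37) shapes), both grids
    (hZ : ∀ μ x, ‖Z μ x‖ ≤ r) (hZ' : ∀ μ x', ‖Z' μ x'‖ ≤ r) (hW : ∀ μ x, ‖W μ x‖ ≤ rB) (hW' : ∀ μ x', ‖W' μ x'‖ ≤ rB)
    (hgrad : ∀ μ x, ‖Z μ x - Z μ ((τ μ).symm x)‖ ≤ η * g) (hgrad' : ∀ μ x', ‖Z' μ x' - Z' μ ((τ' μ).symm x')‖ ≤ η' * g)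
    (hfit : ∀ μ x', ‖Z' μ x' - Z μ (π x')‖ ≤ o) (hfitT : ∀ μ x', ‖Z' μ ((τ' μ).symm x') - Z μ ((τ μ).symm (π x'))‖ ≤ ot)
    (hfitW : ∀ μ x', ‖W' μ ((τ' μ).symm x') - W μ ((τ μ).symm (π x'))‖ ≤ oW)
    (hfitD : ∀ μ x', ‖η'⁻¹ • (Z' μ x' - Z' μ ((τ' μ).symm x')) - η⁻¹ • (Z μ (π x') - Z μ ((τ μ).symm (π x')))‖ ≤ oD)
    -- orthonormal coordinates: the generators are SKEW (dag-n15-w2 `…N15CurvedTransporterOrthogonality`), both grids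
    (hZs : ∀ μ x, (coordMat e (Z μ x))ᵀ = -coordMat e (Z μ x)) (hWs : ∀ μ x, (coordMat e (W μ x))ᵀ = -coordMat e (W μ x))
    (hZs' : ∀ μ x', (coordMat e (Z' μ x'))ᵀ = -coordMat e (Z' μ x')) (hWs' : ∀ μ x', (coordMat e (W' μ x'))ᵀ = -coordMat e (W' μ x'))
    -- the Neumann smallness at the generator-level row letter
    (hq : β * (expRowLetter ι J (basisConst e) r rB g * (1 + Fintype.card (J ⊕ J))) * cr < 1) :
    HasMaj (BlockNorm.ofBlocks geo (liftBlk blk ι)) (BlockNorm.ofBlocks geo (blkPair (liftBlk (blk ∘ π) ι)))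
      (idef (pull (liftMap π ι)) (pull (liftPair (liftMap π ι))) (curvDressed η' τ' (expTrField e η' W') (expTrField e η' Z') G')
        (curvDressed η τ (expTrField e η W) (expTrField e η Z) G))
      (fun y y' => (m * cr + 1 * (m * cr) * (expRowLetter ι J (basisConst e) r rB g * (1 + Fintype.card (J ⊕ J)) *
          (β * (1 - β * (expRowLetter ι J (basisConst e) r rB g * (1 + Fintype.card (J ⊕ J))) * cr)⁻¹)) +
          β * (expFitLetter ι J (basisConst e) r rB g o ot oW oD η * (1 + Fintype.card (J ⊕ J))) *
            (β * (1 - β * (expRowLetter ι J (basisConst e) r rB g * (1 + Fintype.card (J ⊕ J))) * cr)⁻¹) * cr) *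
        (1 - 1 * (β * (expRowLetter ι J (basisConst e) r rB g * (1 + Fintype.card (J ⊕ J))) * cr))⁻¹ * Real.exp (-(ρ * geo.dist y y'))) :=
  hasMaj_idef_curvDressed_exp e blk π η η' τ τ' Z W Z' W' G G' htri hd hσ hcr hrow hρ hρδ hβ hm hreg hregB hη' hη'η hηη₀ hr hrB hg ho hot hoW hoD hG hD hG' hD' hDG hDD
    hZ hZ' hW hW' hgrad hgrad' hfit hfitT hfitW hfitD (expTrField_mul_transpose_of_skew e η Z hZs) (expTrField_transpose_mul_of_skew e η W hWs)
    (expTrField_mul_transpose_of_skew e η W hWs) (expTrField_transpose_eq_of_skew e η W hWs) (expTrField_mul_transpose_of_skew e η' Z' hZs')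
    (expTrField_transpose_mul_of_skew e η' W' hWs') (expTrField_mul_transpose_of_skew e η' W' hWs') (expTrField_transpose_eq_of_skew e η' W' hWs') hq

end Knit

end Summit.QuantumFields.YangMills.BalabanUVNodes.N15.CurvedSpecies

end
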